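import Literature.MathematicalPhysics.QuantumFieldTheory.Balaban1983to89.B9Thm33BindersUniformZdPerNested
import Literature.MathematicalPhysics.QuantumFieldTheory.Balaban1983to89.B9Eq316AveragingSquaresZdPer
import Literature.MathematicalPhysics.QuantumFieldTheory.Balaban1983to89.B9Eq321ProjectorKernelZd
import Literature.MathematicalPhysics.QuantumFieldTheory.Balaban1983to89.B9Thm311FlatHermKernelZd

/-!
# `Balaban1983to89.B9Eq326DeltaAEtaScalingZdPer` — [Balaban1985BackgroundPropagators] (3.26)–(3.27) p. 395 ∕ Thm 3.11 p. 416 ∕ (3.47) p. 398 for the GENUINE periodic record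
# `opsAllZdPer` on the torus `T_P` read on `ℤᵈ`: THE `η`-SCALING FAMILY — every letter of `Δ_a(U₀)` (`D*D` (1.55), `Δ′` (3.10), `D R^per D*` (3.20)–(3.26), `Q*aQ`
# (3.16)) is homogeneous of degree `−2` in the lattice spacing `η`, `G_𝔤^per = (Δ_a)⁻¹` of degree `+2`, the class `𝔄_k({Ω_j}, α₀)` ((1.7)∕(1.9)), the field class `E(Ω₀)`
# and the Landau projection `R^per(U₀)` do not see `η`, and the p. 86 weighted suprema are `η`-balanced; hence the (3.27) binder `InvAtHIPer` and the global (3.47)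
# block `GlobAtIPer` TRANSFER WITH THE SAME CONSTANTS between two members that differ only in the spacing ([Balaban1985RegularSpaces] p. 83 «Let us rescale the
# expressions from T_η to T₁»)

statement-level skeleton of published theorems with citation tags; proofs where landed; nothing here is a claim about the Yang–Mills mass gap

`[Balaban1985BackgroundPropagators]` ("B9", CMP **99** (1985) 389–434): (3.4) p. 391, (3.8)–(3.10) p. 392, (3.16)–(3.17) p. 393, (3.20)–(3.25) p. 394, (3.26)–(3.27) p. 395,
(3.41) p. 397, (3.47) p. 398, Thm 3.3 p. 399, Thm 3.11 p. 416.  `[Balaban1985RegularSpaces]` ("B8", CMP **99** (1985) 75–102): (1.1)–(1.2) p. 76, (1.7)–(1.9) p. 77 with (1.8)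
*«α₀η²(Lʲη)^{−2} = α₀L^{−2j}»*, (1.31) p. 82, (1.55)–(1.58) p. 86 and the norms *«|A|_(α) = sup_j sup_{Ω_j}(Lʲη)^{−α}|A|»* p. 86, p. 77 *«T_η, η = L^{−k}»*, p. 83 *«Let us rescale
the expressions from T_η to T₁»*.  `[Balaban1985Averaging]` ("B7", CMP **98**) (147) p. 40 (the linear averaging at a class background).  PDF held:
`paper:balaban1985-cmp99-background-propagators` pp. 391–398, 416 (re-read by this seat, 2026-08-29).

CITATION HEADER (lean-in-tree rule).  Cell `pub-ymgap` (YM Track A, HUMAN RULING D-0062), DAG node N06 = [B9], seat `pub-ymgap-dag-n06-b` (g26), the (β′-PERIODIC) road.  WHY: this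
seat's `B9Thm33BindersUniformZdPerNested.IdxB8SubDPerκ.binders_uniform_of_eta_law` (p682259) serves the N05 witness slot's five N06 binders with ONE constant set at a fixed period
ONLY UNDER an `η`-LAW on the index (print's `η = L⁻ᵏ`; the tree's law №7 is the relaxation `Lᵏη ≤ 1`), because the per-member constants come from compactness member by
member and two members of the same code `(k, Ω)` may have different spacings.  Referee ref-A g37 (READ-40, WATCH-AI-UNIFORMITY) recorded the binders as «CONDITIONAL-CLOSED»
on that law.  THIS FILE removes the condition at its root: print's construction is scale-covariant — every letter of [B9] Sect. A carries exactly two inverse powers of `η`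
((1.1): `D^η = η⁻¹(R(U)F(x+e) − F(x))`; (3.10): weights `η⁻²(Re U(∂p) − 1)`, `η⁻² Im U(∂p)`; (3.16) in [B8]'s normalisation (1.58): `w_j = (Lʲη)⁻³L^{jd}L^{−j}` against the input
`η·𝟙_{Λ_j}LʲQ_j(U₀)A`; (3.20)–(3.23): the projection onto `Δ^η N(Q′)` is the projection onto `Δ¹ N(Q′)`), the class (1.7)∕(1.9) is written so that `η` cancels ((1.8)), and
the p. 86 norms weigh level `j` by `(Lʲη)^{−α}`.  The companion `B9Thm33BindersUniformZdPerNestedEta` (this seat, next) then proves `binders_uniform` WITHOUT the `η`-law.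

WHAT IS PROVED (kernel, 0 sorry; theorems only — no `def`, no `instance`, no `notation`).
* §1 `weight_eta_mul`, ★ `msup_eta_mul` (`|F|_{(α),cη} = c^{−α}|F|_{(α),η}`), `msup_smul` (`|aF|_(α) = |a|·|F|_(α)`), `bdd_eta_mul_iff`, `bdd_smul_iff` — the real `iSup` of p. 86
  (junk value `0` for unbounded families respected on both sides, `Real.mul_iSup_of_nonneg`).
* §2 `covDerivFwd_eta_mul`, `covDeriv_eta_mul`, `covDiv_eta_mul`, `pdiv_eta_mul`, `pdiv_smul_real`, `covDerivFwd_smul_real` (+ private `NormedRing` twins of the tree's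
  `covDivB_smul_real` ∕ `covLap_smul_real`), `covDivB_eta_mul`, `covLap_eta_mul` (`Δ^{cη} = c⁻²Δ^η`), `plaqCovDeriv_eta_mul`, ★ `Jcur_eta_mul` (`J^{cη} = c⁻²J^η`, (1.55)).
* §3 `zP_eta_mul`, `yP_eta_mul`, `jordanF_eta_mul`, `commG_eta_mul`, ★ `deltaPrimeOp_eta_mul` (abstract lattice, (3.10)), ★ `DpZd_eta_mul` (`Δ′^{cη}(U₀) = c⁻²Δ′^{η}(U₀)` on `ℤᵈ`).
* §4 `wQ_eta_mul` (`c⁻³`), ★★ `QQZdP_eta_mul` (`Q*aQ` at two members with `η′ = cη`, same `Ω`, classes agreeing below the truncation with boxes in `Ω_{j−1}`: `c⁻²`-related at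
  every UNITARY background — on the regime window by dag-n06-b g23's `clsField_eq_smul_of_reg17` + `reg17_shift` + `linCovIterT_smul`, off it both `0`).
* §5 `smul_mem_gaugeNullPer`, ★ `rangeGenPer_eta_mul` (`Δ^{cη}N^per(Q′) = Δ^{η}N^per(Q′)` as SETS, `c ≠ 0`), `rangeSubPer_eta_mul`, ★ `projEPer_eta_mul` ∕ `projRPer_eta_mul`
  (`R^per(U₀)` does not see `η`, EVERY background, no `τ`-hypothesis), `projRPer_smul_real`.
* §6 ★ `DRDs_opsAllZdPer_eta_mul` (`c⁻²`, every background), ★★ `deltaAOf_opsAllZdPer_eta_mul` (`Δ_a^{i′}(U₀)A = c⁻²·Δ_a^{i}(U₀)A` for every unitary `U₀` and every `A`).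
* §7 ★ `inAk_eta_mul_iff` (`𝔄_k({Ω_j}, α₀)` at spacing `cη` = at spacing `η`, `c > 0`), `onDom_eta_mul_iff`.
* §8 `regularAtHPer_iff_of_smul`, `gopZdHPer_smul`, ★ `gopZdHPer_of_smul` (`(κΔ_a)⁻¹ = κ⁻¹(Δ_a)⁻¹` on `E_𝔤^per(P)`, regime iff regime), ★★ `regularAtHPer_opsAllZdPer_eta_iff`
  (THM 3.11's REGIME DOES NOT SEE THE SPACING), ★★ `gop_opsAllZdPer_eta_mul` (`G^{i′}(U₀)J = c²·G^{i}(U₀)J`), `gop_opsAllZdPer_smul`.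
* §9 ★★★ `invAtHIPer_of_eta_mul` (the (3.27) binder transfers from `i` to `i′` with the SAME threshold `aI`), ★★★ `globAtIPer_of_eta_mul` (the (3.47)@−3 block transfers with
  the SAME `(aT, B₀)`: all three entries and `|J|₍₋₃₎` pick up `c³`); `hbox_symm`, ★★★ `invAtHIPer_eta_iff`, ★★★ `globAtIPer_eta_iff` (the relation is symmetric: `↔`).
HYPOTHESES of §4∕§6∕§8∕§9 (the «scaling twin» relation): `i′.η = c·i.η` (`c > 0`), `i′.Ω = i.Ω`, `i′.Λs m l = i.Λs m l` and `𝔅′ m l = 𝔅 m l` for `l ≤ m`, class boxes of `𝔅 m l`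
in `Ω_{l−1}` ([B8] (1.31) — `IdxB8SubDPer.towerBondsP_box` for print's class), `2 ≤ L`, unitary `U₀`.

HONEST SCOPE.  (i) Algebraic homogeneity and bookkeeping of real suprema — NO estimate of Bałaban's is proved or used beyond the cited linearity of the averaging at class
backgrounds; the Hölder binders (3.45) are NOT transferred by scaling (their admissible-pair sets `η·len ≤ 1` move with `η`) — the companion file re-derives them at the
target member from the transferred (3.47) block.  (ii) The transfers keep constants PER CODE `(k, Ω)` at fixed `P`; volume-uniformity in `P` (print's Thm 3.3 ∕ 3.11 «uniformly
in U, Ω_j») is NOT touched.  (iii) Count-neutral; N06 NOT discharged; K1⁹ NOT closed; counts UNMOVED; one finite `𝕋⁴` programme at fixed `ε`, Bałaban as printed; nothing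
continuum ∕ ℝ⁴ ∕ OS ∕ mass gap ∕ Clay.  Unit `pub-ymgap-dag-n06-b` (g26), 2026-08-29; NEW file importing this seat's `B9Thm33BindersUniformZdPerNested` (p682259), dag-n06-b g23's
`B9Eq316AveragingSquaresZdPer`, dag-n06-w4's `B9Eq321ProjectorKernelZd`, dag-n06-w3's `B9Thm311FlatHermKernelZd`; modifies nothing.  Net new unproved facts: 0.
-/

noncomputable section

namespace Literature.MathematicalPhysics.QuantumFieldTheory.Balaban1983to89.B9Eq326DeltaAEtaScalingZdPer

open B7Prop1Explicit B7Prop2Explicit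
open B7Prop1Local (InBox loK bondHiK)
open B7Eq78Linearization (conjR conjR_apply conjR_smul_real QprimeIter zdBlocking)
open B8Ineq132 (covDerivFwd covDeriv covDiv CondAt InAk plaqF BondTouches PlaqTouches)
open B8Eq140Level (SideTouches sideTouches_of_bondTouches)
open B8ScaledSupNorm (weight msup Bdd bondNorm Idx)
open B8Eq138LandauZd (covLap covDivB QT)
open B8Eq143PlaqExpansion (pdiv)
open B8Eq146AExpansion (iEta plaqCovDeriv lin)
open B8Eq155JBound (Jcur)
open B8Eq133Hypotheses (shiftT byDir)
open B8LeafModelZd (ZdIdx)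
open B9Eq39Adjoint (divP divP_smul plaqU)
open B9Eq310Hermitian (deltaPrimeOp zP yP jordanF commG₁ commG₂ commG₃ commG₄ divL divL_smul)
open B9Eq369CurvSmallZd (DpZd)
open B9SupplySockB9P3ZdLetters (OpsZd deltaAOf)
open B9SupplySockB9P3ZdLettersOmega (OnDom)
open B9SupplySockB9P3ZdGammaInAkDpZd (withDpZd)
open B9Eq316AveragingTransposeZd (Reg17 clsField wQ alphaQ alphaQ_pos linCovIterT)
open B9Eq316AveragingTransposeZdPrinted (withQQP QQZdP reg17_shift)
open B9Eq316AveragingTransposeZdLinear (linCovIterT_smul)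
open B9Eq316AveragingSquaresZdPer (clsField_eq_smul_of_reg17)
open B9Eq327GreenZdHermPer (domSubHPer RegularAtHPer InvAtHIPer gopZdHPer withGopZdHPer restrictLinHPer deltaAEquivHPer)
open B9SupplySockB9P3ZdPer (GlobAtIPer)
open B9SupplySockB9P3ZdH2Per (HolderAtIH2Per)
open B9SupplySockB9P3ZdAllLettersZdPer (opsAllZdPer opsLandauPer opsAllZdPer_DRDs opsAllZdPer_Dp opsAllZdPer_QQ opsAllZdPer_Gop deltaAOf_opsAllZdPer_apply)
open B9SupplySockB9P3ZdSrcPer (SrcAtIPer SrcHolderAtIH2Per)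
open B9Eq321LandauProjectionZdPer (perSub gaugeNullPer rangeGenPer rangeSubPer projEPer projRPer)
open B8TowerBondsPrinted (towerBondsP)
open Node00 (Stage3Params IdxB8SubD IdxB8SubDPer IdxB8SubDPerκ)
open T4TermwiseTorus (IsPeriodic tcls)

-- `Site` alone could resolve to the torus sites of `Setup.lean`; re-export the `ℤ^d` sites of `B7Prop1Explicit`.
export B7Prop1Explicit (Site)

variable {d : ℕ}

/-! ## §1  The scaled supremum norms under `η ↦ c·η` -/

section Norms

variable {ι E : Type*} [SeminormedAddCommGroup E]

/-- the level weight scales: `(Lʲ·cη)^{−α} = c^{−α}·(Lʲη)^{−α}` (`c > 0`, `η ≥ 0`). [cite: Balaban1985RegularSpaces, p.86 (definition after (1.55)); p.83 («rescale … from T_η to T₁»)] -/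
theorem weight_eta_mul (L : ℕ) {c η : ℝ} (hc : 0 < c) (hη : 0 ≤ η) (α : ℝ) (j : ℕ) :
    weight L (c * η) α j = c ^ (-α) * weight L η α j := by
  unfold weight
  rw [mul_left_comm, Real.mul_rpow hc.le (mul_nonneg (pow_nonneg (Nat.cast_nonneg _) j) hη)]

/-- **the p. 86 supremum scales with the spacing**: `|F|_{(α), cη} = c^{−α}·|F|_{(α), η}` (`c > 0`, `η ≥ 0`; the real `iSup` convention `0` for unbounded families
is respected on both sides). [cite: Balaban1985RegularSpaces, p.86 (definition after (1.55)); p.83 («rescale … from T_η to T₁»)] -/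
theorem msup_eta_mul (L k : ℕ) {c η : ℝ} (hc : 0 < c) (hη : 0 ≤ η) (α : ℝ) (mem : ℕ → ι → Prop) (F : ι → E) :
    msup L k (c * η) α mem F = c ^ (-α) * msup L k η α mem F := by
  unfold msup
  rw [Real.mul_iSup_of_nonneg (Real.rpow_nonneg hc.le _)]
  refine iSup_congr fun p => ?_
  rw [weight_eta_mul L hc hη α p.1.1, mul_assoc]

variable [NormedSpace ℝ E]

/-- **the p. 86 supremum is absolutely homogeneous in the family**: `|a·F|_(α) = |a|·|F|_(α)`. [cite: Balaban1985RegularSpaces, p.86 (definition after (1.55))] -/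
theorem msup_smul (L k : ℕ) (η α : ℝ) (mem : ℕ → ι → Prop) (a : ℝ) (F F' : ι → E) (h : ∀ i, F' i = a • F i) :
    msup L k η α mem F' = |a| * msup L k η α mem F := by
  unfold msup
  rw [Real.mul_iSup_of_nonneg (abs_nonneg a)]
  refine iSup_congr fun p => ?_
  rw [h, norm_smul, Real.norm_eq_abs, mul_left_comm]

omit [NormedSpace ℝ E] in
/-- boundedness of the weighted family does not see the spacing (`c > 0`, `η ≥ 0`). [cite: Balaban1985RegularSpaces, p.86 (definition after (1.55)); p.83] -/
theorem bdd_eta_mul_iff (L k : ℕ) {c η : ℝ} (hc : 0 < c) (hη : 0 ≤ η) (α : ℝ) (mem : ℕ → ι → Prop) (F : ι → E) :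
    Bdd L k (c * η) α mem F ↔ Bdd L k η α mem F := by
  have hcα : 0 < c ^ (-α) := Real.rpow_pos_of_pos hc _
  constructor
  · rintro ⟨C, hC⟩
    refine ⟨(c ^ (-α))⁻¹ * C, fun j hj i hi => ?_⟩
    have h := hC j hj i hi
    rw [weight_eta_mul L hc hη α j, mul_assoc] at h
    exact (le_inv_mul_iff₀ hcα).2 h
  · rintro ⟨C, hC⟩
    refine ⟨c ^ (-α) * C, fun j hj i hi => ?_⟩
    rw [weight_eta_mul L hc hη α j, mul_assoc]
    exact mul_le_mul_of_nonneg_left (hC j hj i hi) hcα.le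

/-- boundedness of the weighted family is invariant under a non-zero rescaling of the family. [cite: Balaban1985RegularSpaces, p.86 (definition after (1.55))] -/
theorem bdd_smul_iff (L k : ℕ) (η α : ℝ) (mem : ℕ → ι → Prop) {a : ℝ} (ha : a ≠ 0) (F F' : ι → E) (h : ∀ i, F' i = a • F i) :
    Bdd L k η α mem F' ↔ Bdd L k η α mem F := by
  have ha' : 0 < |a| := abs_pos.2 ha
  constructor
  · rintro ⟨C, hC⟩
    refine ⟨|a|⁻¹ * C, fun j hj i hi => ?_⟩
    have h1 := hC j hj i hi
    rw [h, norm_smul, Real.norm_eq_abs, mul_left_comm] at h1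
    exact (le_inv_mul_iff₀ ha').2 h1
  · rintro ⟨C, hC⟩
    refine ⟨|a| * C, fun j hj i hi => ?_⟩
    rw [h, norm_smul, Real.norm_eq_abs, mul_left_comm]
    exact mul_le_mul_of_nonneg_left (hC j hj i hi) ha'.le

end Norms

/-! ## §2  The letters of [B9] Sect. A are homogeneous of degree `−2` in the spacing -/

section Letters

variable {𝔸 : Type*} [NormedRing 𝔸] [NormedAlgebra ℂ 𝔸]

/-- (1.1): `D^{cη}_{V,μ} = c⁻¹·D^η_{V,μ}`. [cite: Balaban1985RegularSpaces, (1.1) p.76, p.83 («rescale … from T_η to T₁»)] -/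
theorem covDerivFwd_eta_mul (c η : ℝ) (V : Site d → Fin d → 𝔸ˣ) (μ : Fin d) (F : Site d → 𝔸) (x : Site d) :
    covDerivFwd (c * η) V μ F x = c⁻¹ • covDerivFwd η V μ F x := by
  simp only [covDerivFwd, mul_inv, mul_smul]

/-- (1.1): `D^{cη*}_{V,ν} = c⁻¹·D^{η*}_{V,ν}`. [cite: Balaban1985RegularSpaces, (1.1) p.76, p.83] -/
theorem covDeriv_eta_mul (c η : ℝ) (V : Site d → Fin d → 𝔸ˣ) (ν : Fin d) (F : Site d → 𝔸) (x : Site d) :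
    covDeriv (c * η) V ν F x = c⁻¹ • covDeriv η V ν F x := by
  simp only [covDeriv, mul_inv, mul_smul]

/-- (1.2): the covariant divergence of the plaquette field scales by `c⁻¹`. [cite: Balaban1985RegularSpaces, (1.2) p.76, p.83] -/
theorem covDiv_eta_mul (c η : ℝ) (V : Site d → Fin d → 𝔸ˣ) (μ : Fin d) (x : Site d) :
    covDiv (c * η) V μ x = c⁻¹ • covDiv η V μ x := by
  simp only [covDiv, covDeriv_eta_mul, smul_sub, Finset.smul_sum]

/-- the plaquette divergence `pdiv` scales by `c⁻¹`. [cite: Balaban1985RegularSpaces, (1.2) p.76, p.83] -/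
theorem pdiv_eta_mul (c η : ℝ) (V : Site d → Fin d → 𝔸ˣ) (F : Fin d → Fin d → Site d → 𝔸) (μ : Fin d) (x : Site d) :
    pdiv (c * η) V F μ x = c⁻¹ • pdiv η V F μ x := by
  simp only [pdiv, covDeriv_eta_mul, smul_sub, Finset.smul_sum]

/-- the plaquette divergence `pdiv` is real-homogeneous in the plaquette function. [cite: Balaban1985RegularSpaces, (1.2) p.76 (bookkeeping)] -/
theorem pdiv_smul_real (η : ℝ) (V : Site d → Fin d → 𝔸ˣ) (a : ℝ) (F : Fin d → Fin d → Site d → 𝔸) (μ : Fin d) (x : Site d) :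
    pdiv η V (a • F) μ x = a • pdiv η V F μ x := by
  simp only [pdiv, covDeriv, Pi.smul_apply, conjR_smul_real, smul_sub, Finset.smul_sum, smul_comm a (η⁻¹ : ℝ)]

/-- `D^η_{V,μ}` is real-homogeneous in the function. [cite: Balaban1985RegularSpaces, (1.1) p.76 (bookkeeping)] -/
theorem covDerivFwd_smul_real (η : ℝ) (V : Site d → Fin d → 𝔸ˣ) (μ : Fin d) (a : ℝ) (F : Site d → 𝔸) (x : Site d) :
    covDerivFwd η V μ (a • F) x = a • covDerivFwd η V μ F x := by
  simp only [covDerivFwd, Pi.smul_apply, conjR_smul_real, ← smul_sub, smul_comm a (η⁻¹ : ℝ)]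

/-- `D^{η*}` on bond fields is real-homogeneous (the tree's `B9Thm311FlatHermKernelZd.covDivB_smul_real`, re-proved in the `NormedRing` generality of this section).
[cite: Balaban1985BackgroundPropagators, (3.8) p.392 (bookkeeping)] -/
private theorem covDivB_smul_real (η : ℝ) (U₀ : Site d → Fin d → 𝔸ˣ) (a : ℝ) (A : Site d → Fin d → 𝔸) (x : Site d) :
    covDivB η U₀ (a • A) x = a • covDivB η U₀ A x := by
  simp only [covDivB, covDeriv, Pi.smul_apply, Finset.smul_sum, smul_sub, conjR_smul_real, smul_comm a (η⁻¹ : ℝ)]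

/-- `Δ^η_{U₀}` is real-homogeneous (the tree's `B9Eq321ProjectorKernelZd.covLap_smul_real`, re-proved in the `NormedRing` generality of this section).
[cite: Balaban1985BackgroundPropagators, (3.23) p.394 (bookkeeping)] -/
private theorem covLap_smul_real (η : ℝ) (U₀ : Site d → Fin d → 𝔸ˣ) (a : ℝ) (f : Site d → 𝔸) (x : Site d) :
    covLap η U₀ (a • f) x = a • covLap η U₀ f x := by
  have h : (fun z μ => covDerivFwd η U₀ μ (a • f) z) = a • fun z μ => covDerivFwd η U₀ μ f z := by
    funext z μ; rw [Pi.smul_apply, Pi.smul_apply, covDerivFwd_smul_real]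
  simp only [covLap]
  rw [h, covDivB_smul_real]

/-- `D^{cη*}` on bond fields scales by `c⁻¹`. [cite: Balaban1985BackgroundPropagators, (3.8) p.392; Balaban1985RegularSpaces, p.83] -/
theorem covDivB_eta_mul (c η : ℝ) (U₀ : Site d → Fin d → 𝔸ˣ) (A : Site d → Fin d → 𝔸) (x : Site d) :
    covDivB (c * η) U₀ A x = c⁻¹ • covDivB η U₀ A x := by
  simp only [covDivB, covDeriv_eta_mul, Finset.smul_sum]

/-- (3.23): `Δ^{cη}_{U₀} = c⁻²·Δ^η_{U₀}`. [cite: Balaban1985BackgroundPropagators, (3.23) p.394; Balaban1985RegularSpaces, p.83] -/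
theorem covLap_eta_mul (c η : ℝ) (U₀ : Site d → Fin d → 𝔸ˣ) (f : Site d → 𝔸) (x : Site d) :
    covLap (c * η) U₀ f x = (c⁻¹ * c⁻¹) • covLap η U₀ f x := by
  have h : (fun z μ => covDerivFwd (c * η) U₀ μ f z) = c⁻¹ • fun z μ => covDerivFwd η U₀ μ f z := by
    funext z μ; simp only [covDerivFwd_eta_mul, Pi.smul_apply]
  simp only [covLap]
  rw [h, covDivB_eta_mul, covDivB_smul_real, smul_smul]

/-- (3.4): the plaquette covariant derivative scales by `c⁻¹`. [cite: Balaban1985BackgroundPropagators, (3.4) p.391; Balaban1985RegularSpaces, p.83] -/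
theorem plaqCovDeriv_eta_mul (c η : ℝ) (U₀ : Site d → Fin d → 𝔸ˣ) (A : Site d → Fin d → 𝔸) (μ ν : Fin d) (x : Site d) :
    plaqCovDeriv (c * η) U₀ A μ ν x = c⁻¹ • plaqCovDeriv η U₀ A μ ν x := by
  simp only [plaqCovDeriv, mul_inv, mul_smul]

/-- ★ **(1.55): THE `D*D` LETTER `J = D^{η*}_{U₀}D^η_{U₀}A` IS HOMOGENEOUS OF DEGREE `−2` IN `η`.** [cite: Balaban1985RegularSpaces, (1.55) p.86, p.83 («rescale … from T_η to T₁»); Balaban1985BackgroundPropagators, (3.10) p.392] -/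
theorem Jcur_eta_mul (c η : ℝ) (U₀ : Site d → Fin d → 𝔸ˣ) (A : Site d → Fin d → 𝔸) (μ : Fin d) (x : Site d) :
    Jcur (c * η) U₀ A μ x = (c⁻¹ * c⁻¹) • Jcur η U₀ A μ x := by
  have h : plaqCovDeriv (c * η) U₀ A = c⁻¹ • plaqCovDeriv η U₀ A := by
    funext μ' ν' x'; simp only [plaqCovDeriv_eta_mul, Pi.smul_apply]
  rw [Jcur, Jcur, h, pdiv_eta_mul, pdiv_smul_real, smul_smul]

end Letters

/-! ## §3  The curvature letter `Δ′(U₀)` of (3.10) is homogeneous of degree `−2` in the spacing -/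

section Curvature

variable {𝔸 : Type*} [Ring 𝔸] [Algebra ℂ 𝔸] {S : Type*} {ι' : Type*} (T : ι' → Equiv.Perm S) (U : ι' → S → 𝔸ˣ)

/-- the weight `z(p) = η⁻²(Re U(∂p) − 1)` of (3.10) scales by `c⁻²`. [cite: Balaban1985BackgroundPropagators, (3.10) p.392] -/
theorem zP_eta_mul (c η : ℝ) (μ ν : ι') (x : S) : zP T U (c * η) μ ν x = (((c : ℂ)⁻¹) ^ 2) • zP T U η μ ν x := by
  simp only [zP, Complex.ofReal_mul, mul_inv, mul_pow, mul_smul]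

/-- the weight `y(p) = η⁻² Im U(∂p)` of (3.10) scales by `c⁻²`. [cite: Balaban1985BackgroundPropagators, (3.10) p.392] -/
theorem yP_eta_mul (c η : ℝ) (μ ν : ι') (x : S) : yP T U (c * η) μ ν x = (((c : ℂ)⁻¹) ^ 2) • yP T U η μ ν x := by
  simp only [yP, Complex.ofReal_mul, mul_inv, mul_pow, mul_smul]

/-- the Jordan-symmetrised first letter function scales by `c⁻²`. [cite: Balaban1985BackgroundPropagators, (3.10) p.392] -/
theorem jordanF_eta_mul (c η : ℝ) (A : ι' → S → 𝔸) : jordanF T U (c * η) A = (((c : ℂ)⁻¹) ^ 2) • jordanF T U η A := by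
  funext μ ν x
  simp only [jordanF, Pi.smul_apply, zP_eta_mul, smul_mul_assoc, mul_smul_comm, ← smul_add]
  rw [smul_comm]

/-- the four commutator letter functions scale by `c⁻²`. [cite: Balaban1985BackgroundPropagators, (3.10) p.392] -/
theorem commG_eta_mul (c η : ℝ) (A : ι' → S → 𝔸) :
    commG₁ T U (c * η) A = (((c : ℂ)⁻¹) ^ 2) • commG₁ T U η A ∧ commG₂ T U (c * η) A = (((c : ℂ)⁻¹) ^ 2) • commG₂ T U η A ∧
      commG₃ T U (c * η) A = (((c : ℂ)⁻¹) ^ 2) • commG₃ T U η A ∧ commG₄ T U (c * η) A = (((c : ℂ)⁻¹) ^ 2) • commG₄ T U η A := by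
  refine ⟨?_, ?_, ?_, ?_⟩
  all_goals
    funext μ ν x
    simp only [commG₁, commG₂, commG₃, commG₄, Pi.smul_apply, yP_eta_mul, mul_smul_comm, smul_mul_assoc, ← smul_sub]
    rw [smul_comm]

variable [Fintype ι'] [LinearOrder ι']

/-- ★ **(3.10): `Δ′^{cη}(U) = c⁻²·Δ′^{η}(U)`** — the curvature letter is homogeneous of degree `−2` in the spacing (its only `η`'s are the weights `η⁻²(Re U(∂p) − 1)`,
`η⁻² Im U(∂p)`). [cite: Balaban1985BackgroundPropagators, (3.10) p.392; Balaban1985RegularSpaces, p.83 («rescale … from T_η to T₁»)] -/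
theorem deltaPrimeOp_eta_mul (c η : ℝ) (A : ι' → S → 𝔸) (μ : ι') (x : S) :
    deltaPrimeOp T U (c * η) A μ x = (((c : ℂ)⁻¹) ^ 2) • deltaPrimeOp T U η A μ x := by
  obtain ⟨h₁, h₂, h₃, h₄⟩ := commG_eta_mul T U c η A
  rw [deltaPrimeOp, deltaPrimeOp, jordanF_eta_mul, h₁, h₂, h₃, h₄, divP_smul, divL_smul, smul_add]

end Curvature

section CurvatureZd

variable {𝔸 : Type*} [CStarAlgebra 𝔸]

/-- ★ **THE GENUINE CURVATURE LETTER ON `ℤᵈ` IS HOMOGENEOUS OF DEGREE `−2`**: `Δ′^{cη}(U₀) = c⁻²·Δ′^{η}(U₀)`.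
[cite: Balaban1985BackgroundPropagators, (3.10) p.392; Balaban1985RegularSpaces, p.83] -/
theorem DpZd_eta_mul (c η : ℝ) (U₀ : Site d → Fin d → 𝔸ˣ) (A : Site d → Fin d → 𝔸) (x : Site d) (μ : Fin d) :
    DpZd (c * η) U₀ A x μ = (c⁻¹ * c⁻¹) • DpZd η U₀ A x μ := by
  rw [DpZd, DpZd, deltaPrimeOp_eta_mul]
  have hc : ((c : ℂ)⁻¹) ^ 2 = ((c⁻¹ * c⁻¹ : ℝ) : ℂ) := by push_cast; ring
  rw [hc, Complex.coe_smul]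

end CurvatureZd

/-! ## §4  The averaging letter `Q*aQ(U₀)` (EDITION P) is homogeneous of degree `−2` at class backgrounds -/

section Averaging

variable {𝔸 : Type*} [CStarAlgebra 𝔸] [FiniteDimensional ℝ 𝔸] [Nontrivial 𝔸] (τ : 𝔸 →ₗ[ℂ] ℂ) {L : ℕ}

omit [FiniteDimensional ℝ 𝔸] [Nontrivial 𝔸] in
/-- the level weight `w_j = (Lʲη)⁻³·L^{jd}L^{−j}` of (3.16) scales by `c⁻³`. [cite: Balaban1985BackgroundPropagators, (3.16)–(3.17) p.393; Balaban1985RegularSpaces, (1.58) p.86] -/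
theorem wQ_eta_mul (L : ℕ) (c η : ℝ) (j : ℕ) : wQ (d := d) L (c * η) j = (c⁻¹ * c⁻¹ * c⁻¹) * wQ (d := d) L η j := by
  unfold wQ
  rw [show ((L : ℝ) ^ j * (c * η)) = c * ((L : ℝ) ^ j * η) by ring, mul_pow, mul_inv]
  ring

/-- ★ **(3.16): `Q*aQ` AT TWO MEMBERS WITH SPACINGS `η′ = cη`, SAME `Ω`, SAME CLASS BELOW THE TRUNCATION, IS `c⁻²`-RELATED AT EVERY UNITARY BACKGROUND** — on the regime
window both letters are print's sums, the level-`j` input `η·𝟙_{Λ_j}(LʲQ_j(U₀)A)` is linear in `η` at a class background (`clsField_eq_smul_of_reg17`, class boxes in `Ω_{j−1}`),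
`Q_jᵀ` is real-linear and `w_j` scales by `c⁻³`; off the window both vanish. [cite: Balaban1985BackgroundPropagators, (3.16)–(3.17) p.393; Balaban1985RegularSpaces, (1.56), (1.58) p.86, (1.31) p.82, (1.7) p.77, p.83] -/
theorem QQZdP_eta_mul (hL : 2 ≤ L) {𝔅 𝔅' : ℕ → ℕ → Set (Site d × Fin d)} {i i' : ZdIdx d L} {m : ℕ} {c : ℝ} (hc : 0 < c)
    (hη : i'.η = c * i.η) (hΩ : i'.Ω = i.Ω) (h𝔅 : ∀ j, j ≤ m → 𝔅' m j = 𝔅 m j)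
    (hbox : ∀ j, j ≤ m → ∀ b ∈ 𝔅 m j, ∀ x, InBox (loK L j b.1) (bondHiK L j b.1 b.2) x → x ∈ i.Ω (j - 1))
    {U₀ : Site d → Fin d → 𝔸ˣ} (hU₀ : ∀ x κ, U₀ x κ ∈ unitaryUnits 𝔸) (A : Site d → Fin d → 𝔸) (y : Site d) (μ : Fin d) :
    QQZdP τ L 𝔅' i' m U₀ A y μ = (c⁻¹ * c⁻¹) • QQZdP τ L 𝔅 i m U₀ A y μ := by
  classical
  have hL1 : 1 ≤ L := le_trans (by norm_num) hL
  unfold QQZdP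
  rw [hΩ]
  by_cases hreg : Reg17 L m i.Ω (alphaQ d L / (L : ℝ) ^ 2) U₀
  · rw [if_pos hreg, if_pos hreg, Finset.smul_sum]
    have hαpos : 0 < alphaQ d L / (L : ℝ) ^ 2 * (L : ℝ) ^ 2 := by
      have := alphaQ_pos d hL1; positivity
    have hαle : alphaQ d L / (L : ℝ) ^ 2 * (L : ℝ) ^ 2 ≤ alphaQ d L := by
      rw [div_mul_cancel₀ _ (by positivity)]
    have hreg' := reg17_shift hL1 hreg
    refine Finset.sum_congr rfl fun j hj => ?_
    have hjm : j ≤ m := Nat.lt_succ_iff.mp (Finset.mem_range.mp hj)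
    have hcls : clsField L 𝔅' i'.η m j U₀ A = c • clsField L 𝔅 i.η m j U₀ A := by
      rw [B9Thm33BindersUniformZdPerNested.clsField_congr (L := L) (η := i'.η) (U₀ := U₀) (h𝔅 j hjm) A]
      funext z κ
      rw [Pi.smul_apply, Pi.smul_apply, clsField_eq_smul_of_reg17 hL hαpos hαle hU₀ hreg' 𝔅 i'.η m hjm (hbox j hjm) A z κ,
        clsField_eq_smul_of_reg17 hL hαpos hαle hU₀ hreg' 𝔅 i.η m hjm (hbox j hjm) A z κ]
      split_ifs
      · rw [hη, mul_smul]
      · rw [smul_zero]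
    rw [hcls, linCovIterT_smul, hη, wQ_eta_mul, smul_smul, smul_smul]
    congr 1
    field_simp
  · rw [if_neg hreg, if_neg hreg, smul_zero]

end Averaging

/-! ## §5  The Landau projection `R^per(U₀)` does not see the spacing; `D R^per D*` is homogeneous of degree `−2` -/

section Landau

variable {𝔸 : Type*} [CStarAlgebra 𝔸] (τ : 𝔸 →ₗ[ℂ] ℂ) (P L m : ℕ) (Λs : ℕ → Set (Site d)) (U₀ : Site d → Fin d → 𝔸ˣ)

/-- `N_𝔤^per(Q′(U₀))` is closed under real scaling. [cite: Balaban1985BackgroundPropagators, (3.21) p.394 (bookkeeping)] -/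
theorem smul_mem_gaugeNullPer {lam : Site d → 𝔸} (h : lam ∈ gaugeNullPer (𝔸 := 𝔸) P L m Λs U₀) (a : ℝ) :
    a • lam ∈ gaugeNullPer (𝔸 := 𝔸) P L m Λs U₀ := by
  refine ⟨fun x => ?_, fun x n => ?_, fun j hj y hy => ?_⟩
  · rw [Pi.smul_apply, IsSelfAdjoint, star_smul, star_trivial, (h.1 x).star_eq]
  · simp only [Pi.smul_apply, h.2.1 x n]
  · have hfun : a • lam = fun x => ((a : ℂ)) • lam x := funext fun x => (Complex.coe_smul a (lam x)).symm
    rw [hfun, B7Eq78Linearization.QprimeIter_smul]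
    simp only [h.2.2 j hj y hy, smul_zero]

/-- ★ **THE GENERATORS `Δ^η_{U₀}N^per(Q′)` DO NOT SEE THE SPACING** (`c ≠ 0`): `Δ^{cη}λ = Δ^η(c⁻²λ)` and `N^per(Q′)` is a real subspace.
[cite: Balaban1985BackgroundPropagators, (3.21)–(3.23) p.394; Balaban1985RegularSpaces, p.83] -/
theorem rangeGenPer_eta_mul (η : ℝ) {c : ℝ} (hc : c ≠ 0) :
    rangeGenPer (𝔸 := 𝔸) P L m (c * η) Λs U₀ = rangeGenPer P L m η Λs U₀ := by
  ext w
  constructor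
  · rintro ⟨lam, hlam, hw⟩
    refine ⟨(c⁻¹ * c⁻¹) • lam, smul_mem_gaugeNullPer P L m Λs U₀ hlam _, ?_⟩
    rw [hw]; funext x; rw [covLap_eta_mul, covLap_smul_real]
  · rintro ⟨lam, hlam, hw⟩
    refine ⟨(c * c) • lam, smul_mem_gaugeNullPer P L m Λs U₀ hlam _, ?_⟩
    rw [hw]; funext x
    rw [covLap_eta_mul, covLap_smul_real, smul_smul, show c⁻¹ * c⁻¹ * (c * c) = 1 by field_simp, one_smul]

/-- `R = span` of the generators does not see the spacing. [cite: Balaban1985BackgroundPropagators, (3.21) p.394] -/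
theorem rangeSubPer_eta_mul (η : ℝ) {c : ℝ} (hc : c ≠ 0) :
    rangeSubPer (𝔸 := 𝔸) P L m (c * η) Λs U₀ = rangeSubPer P L m η Λs U₀ := by
  unfold rangeSubPer; rw [rangeGenPer_eta_mul P L m Λs U₀ η hc]

/-- ★ **`R^per(U₀)` DOES NOT SEE THE SPACING**: `projEPer τ P L m (cη) Λs U₀ = projEPer τ P L m η Λs U₀` (`c ≠ 0`). [cite: Balaban1985BackgroundPropagators, (3.21)–(3.22) p.394; Balaban1985RegularSpaces, p.83] -/
theorem projEPer_eta_mul (η : ℝ) {c : ℝ} (hc : c ≠ 0) :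
    projEPer τ P L m (c * η) Λs U₀ = projEPer τ P L m η Λs U₀ := by
  unfold projEPer; rw [rangeSubPer_eta_mul P L m Λs U₀ η hc]

/-- `R^per(U₀)` read on `ℤᵈ` does not see the spacing. [cite: Balaban1985BackgroundPropagators, (3.21)–(3.22) p.394] -/
theorem projRPer_eta_mul (η : ℝ) {c : ℝ} (hc : c ≠ 0) :
    projRPer τ P L m (c * η) Λs U₀ = projRPer τ P L m η Λs U₀ := by
  funext f x; unfold projRPer; rw [projEPer_eta_mul τ P L m Λs U₀ η hc]

/-- `R^per(U₀)` read on `ℤᵈ` is real-homogeneous. [cite: Balaban1985BackgroundPropagators, (3.21) p.394 («an orthogonal projection»)] -/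
theorem projRPer_smul_real (η : ℝ) (a : ℝ) (f : Site d → 𝔸) :
    projRPer τ P L m η Λs U₀ (a • f) = a • projRPer τ P L m η Λs U₀ f := by
  rw [← B9SupplySockB9P3ZdAllLettersZdPer.projRPerLin_apply, map_smul, B9SupplySockB9P3ZdAllLettersZdPer.projRPerLin_apply]

end Landau

/-! ## §6  `Δ_a(U₀)` of the genuine periodic record at two members with spacings `η′ = cη` -/

section Record

variable {𝔸 : Type*} [CStarAlgebra 𝔸] [FiniteDimensional ℝ 𝔸] [Nontrivial 𝔸] (τ : 𝔸 →ₗ[ℂ] ℂ) (P : ℕ) {L : ℕ}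
  (ops₀ : ℝ → ZdIdx d L → ℕ → OpsZd d 𝔸) (M : ℝ) {𝔅 𝔅' : ℕ → ℕ → Set (Site d × Fin d)} {i i' : ZdIdx d L} {m : ℕ} {c : ℝ}

omit [Nontrivial 𝔸] in
/-- ★ **THE `D R^per D*` LETTER AT TWO MEMBERS WITH SPACINGS `η′ = cη` AND THE SAME CONSTRAINT FAMILY BELOW THE TRUNCATION IS `c⁻²`-RELATED** (`c ≠ 0`; every background).
[cite: Balaban1985BackgroundPropagators, (3.26) p.395, (3.20)–(3.22) p.394; Balaban1985RegularSpaces, p.83] -/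
theorem DRDs_opsAllZdPer_eta_mul (hc : c ≠ 0) (hη : i'.η = c * i.η) (hΛ : ∀ l, l ≤ m → i'.Λs m l = i.Λs m l)
    (U₀ : Site d → Fin d → 𝔸ˣ) (A : Site d → Fin d → 𝔸) :
    (opsAllZdPer τ L P 𝔅' ops₀ M i' m).DRDs U₀ A = (c⁻¹ * c⁻¹) • (opsAllZdPer τ L P 𝔅 ops₀ M i m).DRDs U₀ A := by
  funext x μ
  rw [Pi.smul_apply, Pi.smul_apply, opsAllZdPer_DRDs, opsAllZdPer_DRDs, hη, B9Thm33BindersUniformZdPerNested.projRPer_congr τ hΛ,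
    projRPer_eta_mul τ P L m (i.Λs m) U₀ i.η hc, covDerivFwd_eta_mul]
  have hdiv : covDivB (c * i.η) U₀ A = c⁻¹ • covDivB i.η U₀ A := funext fun z => by rw [Pi.smul_apply, covDivB_eta_mul]
  rw [hdiv, projRPer_smul_real, covDerivFwd_smul_real, smul_smul]

/-- ★★ **`Δ_a(U₀)` OF THE GENUINE PERIODIC RECORD IS HOMOGENEOUS OF DEGREE `−2` IN THE SPACING**: at two members `i, i′` with `η′ = cη` (`c > 0`), the same `Ω`, the same
constraint families below the truncation, and classes agreeing below the truncation whose boxes lie in `Ω_{j−1}` ([B8] (1.31)), `Δ_a^{i′}(U₀)A = c⁻²·Δ_a^{i}(U₀)A` for EVERY unitary `U₀`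
and EVERY `A` — the four letters (1.55)∕(3.10)∕(3.20)–(3.26)∕(3.16) scale alike (print p. 83 «Let us rescale the expressions from T_η to T₁»).
[cite: Balaban1985BackgroundPropagators, (3.26) p.395, (3.10) p.392, (3.16) p.393, (3.20)–(3.23) p.394; Balaban1985RegularSpaces, (1.55), (1.58) p.86, p.83] -/
theorem deltaAOf_opsAllZdPer_eta_mul (hL : 2 ≤ L) (hc : 0 < c) (hη : i'.η = c * i.η) (hΩ : i'.Ω = i.Ω) (hΛ : ∀ l, l ≤ m → i'.Λs m l = i.Λs m l)
    (h𝔅 : ∀ j, j ≤ m → 𝔅' m j = 𝔅 m j) (hbox : ∀ j, j ≤ m → ∀ b ∈ 𝔅 m j, ∀ x, InBox (loK L j b.1) (bondHiK L j b.1 b.2) x → x ∈ i.Ω (j - 1))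
    {U₀ : Site d → Fin d → 𝔸ˣ} (hU₀ : ∀ x κ, U₀ x κ ∈ unitaryUnits 𝔸) (A : Site d → Fin d → 𝔸) :
    deltaAOf i'.η (opsAllZdPer τ L P 𝔅' ops₀ M i' m) U₀ A = (c⁻¹ * c⁻¹) • deltaAOf i.η (opsAllZdPer τ L P 𝔅 ops₀ M i m) U₀ A := by
  have hD := DRDs_opsAllZdPer_eta_mul τ P ops₀ M (𝔅 := 𝔅) (𝔅' := 𝔅') hc.ne' hη hΛ U₀ A
  funext x μ
  have hDx : (opsAllZdPer τ L P 𝔅' ops₀ M i' m).DRDs U₀ A x μ = (c⁻¹ * c⁻¹) • (opsAllZdPer τ L P 𝔅 ops₀ M i m).DRDs U₀ A x μ := by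
    have h := congrFun (congrFun hD x) μ
    simpa only [Pi.smul_apply] using h
  simp only [Pi.smul_apply, deltaAOf, opsAllZdPer_Dp, opsAllZdPer_QQ, smul_add]
  rw [hDx, QQZdP_eta_mul τ hL hc hη hΩ h𝔅 hbox hU₀ A x μ, hη, Jcur_eta_mul, DpZd_eta_mul]

end Record

/-! ## §7  The class `𝔄_k({Ω_j}, α₀)` and the field class `E(Ω₀)` do not see the spacing -/

section Classes

variable {𝔸 : Type*} [CStarAlgebra 𝔸]

/-- ★ **(1.7)∕(1.9): `U₀ ∈ 𝔄_k({Ω_j}, α₀)` DOES NOT SEE THE SPACING** — the plaquette clause (1.7)∕(1.8) has no `η` and in the divergence clause (1.9) both sides carry one factor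
`η⁻¹` (`c, η > 0`). [cite: Balaban1985RegularSpaces, (1.7)–(1.9) p.77, (1.8) p.77 («α₀η²(Lʲη)^{−2} = α₀L^{−2j}»), p.83] -/
theorem inAk_eta_mul_iff (L k : ℕ) {c : ℝ} (hc : 0 < c) (η α : ℝ) (Ω : ℕ → Set (Site d)) (V : Site d → Fin d → 𝔸ˣ) :
    InAk L k (c * η) α Ω V ↔ InAk L k η α Ω V := by
  have key : ∀ j (x : Site d) (μ : Fin d),
      ‖covDiv (c * η) V μ x‖ < α * (((L : ℝ) ^ j)⁻¹) ^ 2 * ((L : ℝ) ^ j * (c * η))⁻¹ ↔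
        ‖covDiv η V μ x‖ < α * (((L : ℝ) ^ j)⁻¹) ^ 2 * ((L : ℝ) ^ j * η)⁻¹ := by
    intro j x μ
    rw [covDiv_eta_mul, norm_smul, Real.norm_eq_abs, abs_of_pos (inv_pos.2 hc),
      show α * (((L : ℝ) ^ j)⁻¹) ^ 2 * ((L : ℝ) ^ j * (c * η))⁻¹ = c⁻¹ * (α * (((L : ℝ) ^ j)⁻¹) ^ 2 * ((L : ℝ) ^ j * η)⁻¹) by
        rw [mul_inv, mul_inv, mul_inv]; ring]
    exact mul_lt_mul_iff_right₀ (inv_pos.2 hc)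
  simp only [InAk, CondAt, key]

/-- **THE FIELD CLASS `E(Ω₀)` (`OnDom`) DOES NOT SEE THE SPACING** (`c > 0`, `η ≥ 0`): the support clause has no `η`, the boundedness clause is `bdd_eta_mul_iff`.
[cite: Balaban1985BackgroundPropagators, (3.41) p.397; Balaban1985RegularSpaces, p.86, p.83] -/
theorem onDom_eta_mul_iff (L m : ℕ) {c η : ℝ} (hc : 0 < c) (hη : 0 ≤ η) (Ω : ℕ → Set (Site d)) (A : Site d → Fin d → 𝔸) :
    OnDom L m (c * η) Ω A ↔ OnDom L m η Ω A := by
  unfold OnDom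
  rw [bdd_eta_mul_iff L m hc hη]

end Classes

/-! ## §8  The propagator `G_𝔤^per(U₀) = (Δ_a)⁻¹` is homogeneous of degree `+2` in the spacing -/

section Green

variable {𝔸 : Type*} [CStarAlgebra 𝔸] (P : ℕ)

/-- **the regime does not see a rescaling of `Δ_a`**: if `Δ_a′(U₀) = κ·Δ_a(U₀)` on all fields (`κ ≠ 0`), then `Δ_a′` is invertible on `E_𝔤^per(P)` iff `Δ_a` is.
[cite: Balaban1985BackgroundPropagators, (3.27) p.395, Thm 3.11 p.416 (bookkeeping)] -/
theorem regularAtHPer_iff_of_smul {η η' : ℝ} {o o' : OpsZd d 𝔸} {U₀ : Site d → Fin d → 𝔸ˣ} {κ : ℝ} (hκ : κ ≠ 0)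
    (h : ∀ A, deltaAOf η' o' U₀ A = κ • deltaAOf η o U₀ A) : RegularAtHPer η' o' P U₀ ↔ RegularAtHPer η o P U₀ := by
  have key : ∀ {η₁ η₂ : ℝ} {o₁ o₂ : OpsZd d 𝔸} {κ' : ℝ}, κ' ≠ 0 → (∀ A, deltaAOf η₂ o₂ U₀ A = κ' • deltaAOf η₁ o₁ U₀ A) →
      RegularAtHPer η₁ o₁ P U₀ → RegularAtHPer η₂ o₂ P U₀ := by
    intro η₁ η₂ o₁ o₂ κ' hκ' h' ⟨Φ, hΦ, hbij⟩
    refine ⟨κ' • Φ, fun A => ?_, ?_, ?_⟩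
    · rw [LinearMap.smul_apply, Submodule.coe_smul, hΦ A, h' A]
    · intro x y hxy
      have h2 : Φ x = Φ y := by
        have := congrArg (fun z => κ'⁻¹ • z) hxy
        simpa only [LinearMap.smul_apply, smul_smul, inv_mul_cancel₀ hκ', one_smul] using this
      exact hbij.1 h2
    · intro y
      obtain ⟨x, hx⟩ := hbij.2 (κ'⁻¹ • y)
      exact ⟨x, by rw [LinearMap.smul_apply, hx, smul_smul, mul_inv_cancel₀ hκ', one_smul]⟩
  refine ⟨key (κ' := κ⁻¹) (inv_ne_zero hκ) fun A => ?_, key hκ h⟩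
  rw [h A, smul_smul, inv_mul_cancel₀ hκ, one_smul]

/-- `G_𝔤^per` is real-homogeneous in the source `J`, always. [cite: Balaban1985BackgroundPropagators, (3.27) p.395 (bookkeeping)] -/
theorem gopZdHPer_smul (η : ℝ) (o : OpsZd d 𝔸) (U₀ : Site d → Fin d → 𝔸ˣ) (a : ℝ) (J : Site d → Fin d → 𝔸) :
    gopZdHPer η o P U₀ (a • J) = a • gopZdHPer η o P U₀ J := by
  by_cases hr : RegularAtHPer η o P U₀
  · rw [B9Eq327GreenZdHermPer.gopZdHPer_of_regularAtHPer η o P U₀ hr, B9Eq327GreenZdHermPer.gopZdHPer_of_regularAtHPer η o P U₀ hr, map_smul,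
      map_smul, Submodule.coe_smul]
  · rw [B9Eq327GreenZdHermPer.gopZdHPer_of_not_regularAtHPer η o P U₀ hr, B9Eq327GreenZdHermPer.gopZdHPer_of_not_regularAtHPer η o P U₀ hr, smul_zero]

/-- ★ **`(κ·Δ_a)⁻¹ = κ⁻¹·(Δ_a)⁻¹` ON `E_𝔤^per(P)`**: if `Δ_a′(U₀) = κ·Δ_a(U₀)` on all fields (`κ ≠ 0`), then `G′ = κ⁻¹·G` (in the regime both are the inverses; off it both
are `0`). [cite: Balaban1985BackgroundPropagators, (3.27) p.395; Balaban1985RegularSpaces, p.83 («rescale … from T_η to T₁»)] -/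
theorem gopZdHPer_of_smul {η η' : ℝ} {o o' : OpsZd d 𝔸} {U₀ : Site d → Fin d → 𝔸ˣ} {κ : ℝ} (hκ : κ ≠ 0)
    (h : ∀ A, deltaAOf η' o' U₀ A = κ • deltaAOf η o U₀ A) (J : Site d → Fin d → 𝔸) :
    gopZdHPer η' o' P U₀ J = κ⁻¹ • gopZdHPer η o P U₀ J := by
  by_cases hr : RegularAtHPer η o P U₀
  · have hr' : RegularAtHPer η' o' P U₀ := (regularAtHPer_iff_of_smul P hκ h).2 hr
    rw [B9Eq327GreenZdHermPer.gopZdHPer_of_regularAtHPer η' o' P U₀ hr', B9Eq327GreenZdHermPer.gopZdHPer_of_regularAtHPer η o P U₀ hr]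
    set e := deltaAEquivHPer η o P U₀ hr with he
    set e' := deltaAEquivHPer η' o' P U₀ hr' with he'
    set x := e.symm (restrictLinHPer P J) with hx
    set x' := e'.symm (restrictLinHPer P J) with hx'
    rw [← Submodule.coe_smul]
    congr 1
    apply e'.injective
    have h1 : e' x' = restrictLinHPer P J := by rw [hx', LinearEquiv.apply_symm_apply]
    have h2 : e x = restrictLinHPer P J := by rw [hx, LinearEquiv.apply_symm_apply]
    have h3 : e' x = κ • e x := by
      apply Subtype.ext
      rw [B9Eq327GreenZdHermPer.deltaAEquivHPer_coe, Submodule.coe_smul, B9Eq327GreenZdHermPer.deltaAEquivHPer_coe, h]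
    rw [h1, map_smul, h3, smul_smul, inv_mul_cancel₀ hκ, one_smul, h2]
  · have hr' : ¬ RegularAtHPer η' o' P U₀ := fun h' => hr ((regularAtHPer_iff_of_smul P hκ h).1 h')
    rw [B9Eq327GreenZdHermPer.gopZdHPer_of_not_regularAtHPer η' o' P U₀ hr', B9Eq327GreenZdHermPer.gopZdHPer_of_not_regularAtHPer η o P U₀ hr,
      smul_zero]

variable [FiniteDimensional ℝ 𝔸] [Nontrivial 𝔸] (τ : 𝔸 →ₗ[ℂ] ℂ) {L : ℕ} (ops₀ : ℝ → ZdIdx d L → ℕ → OpsZd d 𝔸) (M : ℝ)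
  {𝔅 𝔅' : ℕ → ℕ → Set (Site d × Fin d)} {i i' : ZdIdx d L} {m : ℕ} {c : ℝ}

/-- ★★ **THEOREM 3.11's REGIME ON THE TORUS DOES NOT SEE THE SPACING**: at two members with `η′ = cη` (`c > 0`), the same `Ω`, the same constraint families and classes below
the truncation (class boxes in `Ω_{j−1}`), `Δ_a(U₀)` of the genuine record is invertible on `E_𝔤^per(P)` at `i′` iff at `i`, for every unitary `U₀`.
[cite: Balaban1985BackgroundPropagators, Thm 3.11 p.416, (3.26)–(3.27) p.395; Balaban1985RegularSpaces, p.83] -/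
theorem regularAtHPer_opsAllZdPer_eta_iff (hL : 2 ≤ L) (hc : 0 < c) (hη : i'.η = c * i.η) (hΩ : i'.Ω = i.Ω) (hΛ : ∀ l, l ≤ m → i'.Λs m l = i.Λs m l)
    (h𝔅 : ∀ j, j ≤ m → 𝔅' m j = 𝔅 m j) (hbox : ∀ j, j ≤ m → ∀ b ∈ 𝔅 m j, ∀ x, InBox (loK L j b.1) (bondHiK L j b.1 b.2) x → x ∈ i.Ω (j - 1))
    {U₀ : Site d → Fin d → 𝔸ˣ} (hU₀ : ∀ x κ, U₀ x κ ∈ unitaryUnits 𝔸) :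
    RegularAtHPer i'.η (opsAllZdPer τ L P 𝔅' ops₀ M i' m) P U₀ ↔ RegularAtHPer i.η (opsAllZdPer τ L P 𝔅 ops₀ M i m) P U₀ :=
  regularAtHPer_iff_of_smul P (κ := c⁻¹ * c⁻¹) (by positivity) (deltaAOf_opsAllZdPer_eta_mul τ P ops₀ M hL hc hη hΩ hΛ h𝔅 hbox hU₀)

/-- ★★ **`G_𝔤^per(U₀)` OF THE GENUINE RECORD IS HOMOGENEOUS OF DEGREE `+2` IN THE SPACING**: `G^{i′}(U₀)J = c²·G^{i}(U₀)J` (same hypotheses).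
[cite: Balaban1985BackgroundPropagators, (3.27) p.395, Thm 3.11 p.416; Balaban1985RegularSpaces, (1.58) p.86, p.83 («rescale … from T_η to T₁»)] -/
theorem gop_opsAllZdPer_eta_mul (hL : 2 ≤ L) (hc : 0 < c) (hη : i'.η = c * i.η) (hΩ : i'.Ω = i.Ω) (hΛ : ∀ l, l ≤ m → i'.Λs m l = i.Λs m l)
    (h𝔅 : ∀ j, j ≤ m → 𝔅' m j = 𝔅 m j) (hbox : ∀ j, j ≤ m → ∀ b ∈ 𝔅 m j, ∀ x, InBox (loK L j b.1) (bondHiK L j b.1 b.2) x → x ∈ i.Ω (j - 1))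
    {U₀ : Site d → Fin d → 𝔸ˣ} (hU₀ : ∀ x κ, U₀ x κ ∈ unitaryUnits 𝔸) (J : Site d → Fin d → 𝔸) :
    (opsAllZdPer τ L P 𝔅' ops₀ M i' m).Gop U₀ J = (c * c) • (opsAllZdPer τ L P 𝔅 ops₀ M i m).Gop U₀ J := by
  rw [opsAllZdPer_Gop, opsAllZdPer_Gop]
  have h := gopZdHPer_of_smul P (κ := c⁻¹ * c⁻¹) (by positivity)
    (η := i.η) (η' := i'.η) (o := opsLandauPer τ P (withDpZd (withQQP τ L 𝔅 ops₀)) M i m)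
    (o' := opsLandauPer τ P (withDpZd (withQQP τ L 𝔅' ops₀)) M i' m) (U₀ := U₀)
    (fun A => deltaAOf_opsAllZdPer_eta_mul τ P ops₀ M hL hc hη hΩ hΛ h𝔅 hbox hU₀ A) J
  rw [h, mul_inv, inv_inv]

omit [Nontrivial 𝔸] in
/-- `G_𝔤^per` of the genuine record is real-homogeneous in the source. [cite: Balaban1985BackgroundPropagators, (3.27) p.395 (bookkeeping)] -/
theorem gop_opsAllZdPer_smul (U₀ : Site d → Fin d → 𝔸ˣ) (a : ℝ) (J : Site d → Fin d → 𝔸) :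
    (opsAllZdPer τ L P 𝔅 ops₀ M i m).Gop U₀ (a • J) = a • (opsAllZdPer τ L P 𝔅 ops₀ M i m).Gop U₀ J := by
  rw [opsAllZdPer_Gop, opsAllZdPer_Gop, gopZdHPer_smul]

end Green

/-! ## §9  The (3.27) binder and the (3.47) block transfer between members with different spacings -/

section Binders

variable {𝔸 : Type*} [CStarAlgebra 𝔸] [FiniteDimensional ℝ 𝔸] [Nontrivial 𝔸] (τ : 𝔸 →ₗ[ℂ] ℂ) (P : ℕ) {L : ℕ}
  (ops₀ : ℝ → ZdIdx d L → ℕ → OpsZd d 𝔸) (M : ℝ) {𝔅 𝔅' : ℕ → ℕ → Set (Site d × Fin d)} {i i' : ZdIdx d L} {m : ℕ} {c : ℝ}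

/-- `c ^ (−(−1)) = c` (real exponent). [folklore] -/
private theorem rpow_neg_neg_one (c : ℝ) : c ^ (-(-(1 : ℝ))) = c := by
  rw [neg_neg, Real.rpow_one]

/-- `c ^ (−(−2)) = c²` (real exponent). [folklore] -/
private theorem rpow_neg_neg_two (c : ℝ) : c ^ (-(-(2 : ℝ))) = c ^ 2 := by
  rw [neg_neg, Real.rpow_two]

/-- `c ^ (−(−3)) = c³` (real exponent). [folklore] -/
private theorem rpow_neg_neg_three (c : ℝ) : c ^ (-(-(3 : ℝ))) = c ^ 3 := by
  rw [neg_neg, show (3 : ℝ) = ((3 : ℕ) : ℝ) by norm_num, Real.rpow_natCast]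

/-- ★★★ **THE (3.27) BINDER `InvAtHIPer` TRANSFERS BETWEEN MEMBERS WITH DIFFERENT SPACINGS WITH THE SAME THRESHOLD**: at two members with `η′ = cη` (`c > 0`), the same
`Ω`, the same constraint families and classes below the truncation (class boxes in `Ω_{j−1}`), `InvAtHIPer … aI M i m → InvAtHIPer … aI M i′ m` — the class (1.7)∕(1.9) and
the field class do not see the spacing, `Δ_a` scales by `c⁻²` and `G_𝔤^per` by `c²`. [cite: Balaban1985BackgroundPropagators, (3.27) p.395, Thm 3.11 p.416; Balaban1985RegularSpaces, (1.7)–(1.9) p.77, (1.58) p.86, p.83 («rescale … from T_η to T₁»)] -/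
theorem invAtHIPer_of_eta_mul (hL : 2 ≤ L) (hc : 0 < c) (hη : i'.η = c * i.η) (hΩ : i'.Ω = i.Ω) (hΛ : ∀ l, l ≤ m → i'.Λs m l = i.Λs m l)
    (h𝔅 : ∀ j, j ≤ m → 𝔅' m j = 𝔅 m j) (hbox : ∀ j, j ≤ m → ∀ b ∈ 𝔅 m j, ∀ x, InBox (loK L j b.1) (bondHiK L j b.1 b.2) x → x ∈ i.Ω (j - 1))
    {aI : ℝ} (hI : InvAtHIPer P L (opsAllZdPer τ L P 𝔅 ops₀) aI M i m) : InvAtHIPer P L (opsAllZdPer τ L P 𝔅' ops₀) aI M i' m := by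
  intro α₀ U₀ hU₀ hper hα hIn' A hAp hA' hsa J' hJ'
  have hηpos : 0 < i.η := i.hη
  have hIn : InAk L m i.η α₀ i.Ω U₀ := by
    rw [hη, hΩ] at hIn'; exact (inAk_eta_mul_iff L m hc i.η α₀ i.Ω U₀).1 hIn'
  have hA : OnDom L m i.η i.Ω A := by
    rw [hη, hΩ] at hA'; exact (onDom_eta_mul_iff L m hc hηpos.le i.Ω A).1 hA'
  have hΔ := deltaAOf_opsAllZdPer_eta_mul τ P ops₀ M hL hc hη hΩ hΛ h𝔅 hbox hU₀ A
  have hJ : ∀ (y : Site d) (κ : Fin d), BondTouches (i.Ω 0) y κ →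
      ((c * c) • J') y κ = deltaAOf i.η (opsAllZdPer τ L P 𝔅 ops₀ M i m) U₀ A y κ := by
    intro y κ hb
    rw [← hΩ] at hb
    rw [Pi.smul_apply, Pi.smul_apply, hJ' y κ hb, hΔ, Pi.smul_apply, Pi.smul_apply, smul_smul,
      show c * c * (c⁻¹ * c⁻¹) = 1 by field_simp, one_smul]
  have hG := hI α₀ U₀ hU₀ hper hα hIn A hAp hA hsa ((c * c) • J') hJ
  rw [gop_opsAllZdPer_smul] at hG
  rw [gop_opsAllZdPer_eta_mul P τ ops₀ M hL hc hη hΩ hΛ h𝔅 hbox hU₀ J', hG]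

/-- ★★★ **THE GLOBAL (3.47) BLOCK `GlobAtIPer` TRANSFERS BETWEEN MEMBERS WITH DIFFERENT SPACINGS WITH THE SAME CONSTANTS** (same hypotheses): the three weighted entries
`|G J|₍₋₁₎, |∇_{U₀}G J|₍₋₂₎, |Δ_{U₀}G J|₍₋₃₎` and `|J|₍₋₃₎` all pick up the factor `c³` — (3.47)'s weights are `η`-balanced.
[cite: Balaban1985BackgroundPropagators, (3.47) p.398, Thm 3.3 p.399; Balaban1985RegularSpaces, (1.59) p.86, p.86 (the norms), p.83 («rescale … from T_η to T₁»)] -/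
theorem globAtIPer_of_eta_mul (hL : 2 ≤ L) (hc : 0 < c) (hη : i'.η = c * i.η) (hΩ : i'.Ω = i.Ω) (hΛ : ∀ l, l ≤ m → i'.Λs m l = i.Λs m l)
    (h𝔅 : ∀ j, j ≤ m → 𝔅' m j = 𝔅 m j) (hbox : ∀ j, j ≤ m → ∀ b ∈ 𝔅 m j, ∀ x, InBox (loK L j b.1) (bondHiK L j b.1 b.2) x → x ∈ i.Ω (j - 1))
    {aT B₀ : ℝ} (hG : GlobAtIPer P L (opsAllZdPer τ L P 𝔅 ops₀) aT B₀ M i m) : GlobAtIPer P L (opsAllZdPer τ L P 𝔅' ops₀) aT B₀ M i' m := by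
  intro α₀ U₀ hU₀ hper hα hαT hIn' J hJ
  have hηpos : 0 < i.η := i.hη
  have hIn : InAk L m i.η α₀ i.Ω U₀ := by
    rw [hη, hΩ] at hIn'; exact (inAk_eta_mul_iff L m hc i.η α₀ i.Ω U₀).1 hIn'
  obtain ⟨h0, h1, h3⟩ := hG α₀ U₀ hU₀ hper hα hαT hIn J hJ
  have hgop := gop_opsAllZdPer_eta_mul P τ ops₀ M hL hc hη hΩ hΛ h𝔅 hbox hU₀ J
  obtain ⟨G, hGdef⟩ : ∃ G, (opsAllZdPer τ L P 𝔅 ops₀ M i m).Gop U₀ J = G := ⟨_, rfl⟩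
  rw [hGdef] at h0 h1 h3 hgop
  rw [hgop]
  obtain ⟨NJ, hNJ⟩ : ∃ NJ, bondNorm L m i.η (-(3 : ℝ)) i.Ω J = NJ := ⟨_, rfl⟩
  rw [hNJ] at h0 h1 h3
  have hNJ' : bondNorm L m i'.η (-(3 : ℝ)) i'.Ω J = c ^ 3 * NJ := by
    rw [← hNJ, bondNorm, bondNorm, hη, hΩ, msup_eta_mul L m hc hηpos.le, rpow_neg_neg_three]
  have hc3 : (0 : ℝ) ≤ c ^ 3 := by positivity
  rw [hNJ', hΩ, hη]
  refine ⟨?_, ?_, ?_⟩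
  · -- entry 0: `|c²·G J|₍₋₁₎ at spacing cη = c·c²·|G J|₍₋₁₎`
    rw [msup_eta_mul L m hc hηpos.le, rpow_neg_neg_one,
      msup_smul L m i.η (-(1 : ℝ)) _ (c * c) (fun b : Site d × Fin d => G b.1 b.2) (fun b => ((c * c) • G) b.1 b.2) (fun _ => rfl),
      abs_of_pos (by positivity : 0 < c * c),
      show c * (c * c * msup L m i.η (-(1 : ℝ)) (fun j (b : Site d × Fin d) => SideTouches (i.Ω j) b.1 b.2) (fun b => G b.1 b.2)) =
        c ^ 3 * msup L m i.η (-(1 : ℝ)) (fun j (b : Site d × Fin d) => SideTouches (i.Ω j) b.1 b.2) (fun b => G b.1 b.2) by ring,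
      mul_left_comm]
    exact mul_le_mul_of_nonneg_left h0 hc3
  · -- entry 1: `∇^{cη}(c²G) = c·∇^η G`, weight `c²`
    have hfam : ∀ t : Fin d × Fin d × Site d, covDerivFwd (c * i.η) U₀ t.1 (fun z => ((c * c) • G) z t.2.1) t.2.2 =
        c • covDerivFwd i.η U₀ t.1 (fun z => G z t.2.1) t.2.2 := fun t => by
      have hfun : (fun z => ((c * c) • G) z t.2.1) = (c * c) • fun z => G z t.2.1 := rfl
      rw [hfun, covDerivFwd_eta_mul, covDerivFwd_smul_real, smul_smul, show c⁻¹ * (c * c) = c by field_simp]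
    rw [msup_eta_mul L m hc hηpos.le, rpow_neg_neg_two,
      msup_smul L m i.η (-(2 : ℝ)) _ c (fun t : Fin d × Fin d × Site d => covDerivFwd i.η U₀ t.1 (fun z => G z t.2.1) t.2.2) _ hfam,
      abs_of_pos hc, ← mul_assoc, show c ^ 2 * c = c ^ 3 by ring, mul_left_comm]
    exact mul_le_mul_of_nonneg_left h1 hc3
  · -- entry 3: `Δ^{cη}(c²G) = Δ^η G`, weight `c³`
    have hfam : (fun x μ => covLap (c * i.η) U₀ (fun z => ((c * c) • G) z μ) x) = fun x μ => covLap i.η U₀ (fun z => G z μ) x := by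
      funext x μ
      have hfun : (fun z => ((c * c) • G) z μ) = (c * c) • fun z => G z μ := rfl
      rw [hfun, covLap_eta_mul, covLap_smul_real, smul_smul, show c⁻¹ * c⁻¹ * (c * c) = 1 by field_simp, one_smul]
    rw [hfam, bondNorm, msup_eta_mul L m hc hηpos.le, rpow_neg_neg_three, mul_left_comm]
    exact mul_le_mul_of_nonneg_left h3 hc3

/-- the «scaling twin» relation is symmetric: the class boxes of `𝔅′` lie in `Ω′_{l−1}`. [cite: Balaban1985RegularSpaces, (1.31) p.82 (bookkeeping)] -/
theorem hbox_symm (hΩ : i'.Ω = i.Ω) (h𝔅 : ∀ j, j ≤ m → 𝔅' m j = 𝔅 m j)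
    (hbox : ∀ j, j ≤ m → ∀ b ∈ 𝔅 m j, ∀ x, InBox (loK L j b.1) (bondHiK L j b.1 b.2) x → x ∈ i.Ω (j - 1)) :
    ∀ j, j ≤ m → ∀ b ∈ 𝔅' m j, ∀ x, InBox (loK L j b.1) (bondHiK L j b.1 b.2) x → x ∈ i'.Ω (j - 1) := by
  intro j hj b hb x hx
  rw [h𝔅 j hj] at hb
  rw [hΩ]
  exact hbox j hj b hb x hx

/-- ★★★ **THE (3.27) BINDER AT TWO SCALING-TWIN MEMBERS IS THE SAME STATEMENT** (`↔`, same threshold). [cite: Balaban1985BackgroundPropagators, (3.27) p.395, Thm 3.11 p.416; Balaban1985RegularSpaces, p.83] -/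
theorem invAtHIPer_eta_iff (hL : 2 ≤ L) (hc : 0 < c) (hη : i'.η = c * i.η) (hΩ : i'.Ω = i.Ω) (hΛ : ∀ l, l ≤ m → i'.Λs m l = i.Λs m l)
    (h𝔅 : ∀ j, j ≤ m → 𝔅' m j = 𝔅 m j) (hbox : ∀ j, j ≤ m → ∀ b ∈ 𝔅 m j, ∀ x, InBox (loK L j b.1) (bondHiK L j b.1 b.2) x → x ∈ i.Ω (j - 1)) (aI : ℝ) :
    InvAtHIPer P L (opsAllZdPer τ L P 𝔅' ops₀) aI M i' m ↔ InvAtHIPer P L (opsAllZdPer τ L P 𝔅 ops₀) aI M i m := by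
  refine ⟨fun h => ?_, fun h => invAtHIPer_of_eta_mul τ P ops₀ M hL hc hη hΩ hΛ h𝔅 hbox h⟩
  have hη' : i.η = c⁻¹ * i'.η := by rw [hη, ← mul_assoc, inv_mul_cancel₀ hc.ne', one_mul]
  exact invAtHIPer_of_eta_mul τ P ops₀ M hL (inv_pos.2 hc) hη' hΩ.symm (fun l hl => (hΛ l hl).symm) (fun j hj => (h𝔅 j hj).symm)
    (hbox_symm hΩ h𝔅 hbox) h

/-- ★★★ **THE (3.47)@−3 BLOCK AT TWO SCALING-TWIN MEMBERS IS THE SAME STATEMENT** (`↔`, same constants). [cite: Balaban1985BackgroundPropagators, (3.47) p.398, Thm 3.3 p.399; Balaban1985RegularSpaces, (1.59) p.86, p.83] -/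
theorem globAtIPer_eta_iff (hL : 2 ≤ L) (hc : 0 < c) (hη : i'.η = c * i.η) (hΩ : i'.Ω = i.Ω) (hΛ : ∀ l, l ≤ m → i'.Λs m l = i.Λs m l)
    (h𝔅 : ∀ j, j ≤ m → 𝔅' m j = 𝔅 m j) (hbox : ∀ j, j ≤ m → ∀ b ∈ 𝔅 m j, ∀ x, InBox (loK L j b.1) (bondHiK L j b.1 b.2) x → x ∈ i.Ω (j - 1)) (aT B₀ : ℝ) :
    GlobAtIPer P L (opsAllZdPer τ L P 𝔅' ops₀) aT B₀ M i' m ↔ GlobAtIPer P L (opsAllZdPer τ L P 𝔅 ops₀) aT B₀ M i m := by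
  refine ⟨fun h => ?_, fun h => globAtIPer_of_eta_mul τ P ops₀ M hL hc hη hΩ hΛ h𝔅 hbox h⟩
  have hη' : i.η = c⁻¹ * i'.η := by rw [hη, ← mul_assoc, inv_mul_cancel₀ hc.ne', one_mul]
  exact globAtIPer_of_eta_mul τ P ops₀ M hL (inv_pos.2 hc) hη' hΩ.symm (fun l hl => (hΛ l hl).symm) (fun j hj => (h𝔅 j hj).symm)
    (hbox_symm hΩ h𝔅 hbox) h

end Binders

end Literature.MathematicalPhysics.QuantumFieldTheory.Balaban1983to89.B9Eq326DeltaAEtaScalingZdPer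

end
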